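import Summits.ValiantsHypothesis.ValiantsHypothesis.Theorems.DefinabilityGapForestSums
import Summits.ValiantsHypothesis.ValiantsHypothesis.Theorems.DefinabilityGapThreeMatchings
import HarnessLib

/-!
# Definability gap — graphical gates: prime edge images and two gates under patches

Helper-lane file F-M₁ of OFFER O-L5-MASON (decomp-val-lens-5 g39; RULING sub-scope (b): the kernel draft of F-M
exceeded the line limit and is split into THIS file and `DefinabilityGapGraphicalThree`, which imports it) on the
`KIPlantedHittingRO` helper lane (`stmt-ValiantsHypothesis-23704`). A GRAPHICAL GATE is a product of differences
`z_u − z_v` of block variables over an edge multiset `E` (`eprod E`, the one data definition; multiplicities =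
powers); `φ = bind₁ (kiPer m)` is the Kabanets–Impagliazzo planted map `z_c ↦ P_c` and `φ_L` its merged version
along a patch list `L` (`wordL`, `DefinabilityGapClusterMerging`). Tools only: this file proves NOTHING about three
gates, closes NO item, earns 0 S-currency, and is NOT claimed to bear on `KIPlantedHitting` (K1).

* GATES: `eprod`; substitution / relabelling factor by factor (`bind₁_eprod`, `rename_eprod`); a loop kills a gate;
  `deg (eprod E) ≤ |E|`; `φ(eprod E)` is homogeneous of degree `|E|·m`, nonzero for loopless `E` (by name:
  `kiPer_isHomogeneous`, `kiPer_linearIndependent`).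
* EDGE IMAGES: `q_e := P_u − P_v` is PRIME for `u ≠ v` (`prime_kiPer_sub` ← `prime_bind₁_kiPer_of_totalDegree_le_one`)
  and RIGID on ORIENTED edges `u < v` (lexicographic): `q_e ∣ q_e' ⟹ e = e'` (`edge_eq_of_dvd` ←
  `exists_eq_C_mul_of_associated`); so `q_e ∤ α·φ(eprod E)` for oriented `E ∌ e`, `α ≠ 0` (`not_dvd_kiPer_gate`).
* TWO GATES UNDER PATCHES (`bind₁_wordL_twoGates_ne_zero`): `L` with distinct merged blocks, `2·3^(|L|+1) < m²`, two
  gates on loopless edges off the merged blocks: `β·eprod A + γ·eprod B ≠ 0 ⟹ φ_L(…) ≠ 0`, by induction on `|A| + |B|`: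
  a zero coefficient or a gate SURVIVES factorwise (`wordPoly_wordL_ne'`); an edge `e = (u, v)` of `A` neither in `B`
  nor reversed in `B` is MERGED — `φ_{e::L}` KILLS `eprod A` (`wordL_snd_eq`), `B` is relabelled for free by the
  collapse `ρ_e = repL [e]` (CONTRACT `bind₁_wordL_rename_repL`: `φ_L ∘ ρ_e = φ_L` for `e ∈ L`), SURVIVES, and `≠ 0`
  TRANSFERS to `φ_L` (`bind₁_wordL_ne_zero_of_cons`); else the edge sets agree up to orientation and a common factor
  `z_u − z_v = −(z_v − z_u)` is peeled. Merging facts BY NAME (`DefinabilityGapClusterMerging`, `…ForestSums`).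

HONEST BOUNDARY: graphical gates of top fan-in 3 only (products of differences z_u − z_v over ORIENTED edge
multisets), m ≥ 5; graphical fan-in ≥ 4 on cyclic union supports, affine non-graphical gates (β) and the leaf regime
(γ) are NOT claimed and no road to them is offered (the k-term Mason constant (k−1)(k−2)/2 ≥ 3 defeats the count for
k ≥ 4; the free-form recursion one level down would need Mason–Stothers over a PATCHED pencil, not in tree);
0 S-currency; closes NO item; K1 / stmt-23704 text / VP ≠ VNP untouched.

ELEMENTARY · tools (the NEW-COMBINATION is made in `DefinabilityGapGraphicalThree`) · INCOMPARABLE-by-design with the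
forest / matching files (no support hypothesis; cycle structure plays no role here) · 0 S-currency · closes NO item.
Citations in prose only: Kabanets–Impagliazzo 2003, Nisan–Wigderson 1994 (the lane).
-/

noncomputable section

open MvPolynomial
open Summit.ValiantsHypothesis.ValiantsHypothesis.Theorems.DefinabilityGapAffineRung
open Summit.ValiantsHypothesis.ValiantsHypothesis.Theorems.DefinabilityGapBlockMerging
open Summit.ValiantsHypothesis.ValiantsHypothesis.Theorems.DefinabilityGapClusterMerging
open Summit.ValiantsHypothesis.ValiantsHypothesis.Theorems.DefinabilityGapForestSums
open Summit.ValiantsHypothesis.ValiantsHypothesis.Theorems.DefinabilityGapSigmaPiSigmaTwo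

set_option linter.dupNamespace false

namespace Summit.ValiantsHypothesis.ValiantsHypothesis.Theorems.DefinabilityGapEdgeGates

variable {m : ℕ}

/-- The GATE of an edge multiset: `eprod E = Π_{(u,v) ∈ E} (z_u − z_v)` (multiplicities = powers). [this file] -/
def eprod (E : Multiset ((Fin 3 → Fin (qOf m)) × (Fin 3 → Fin (qOf m)))) :
    MvPolynomial (Fin 3 → Fin (qOf m)) ℂ :=
  (E.map fun e => X e.1 - X e.2).prod

/-- The empty gate is `1`. [this file] -/
theorem eprod_zero : eprod (0 : Multiset ((Fin 3 → Fin (qOf m)) × (Fin 3 → Fin (qOf m)))) = 1 := by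
  unfold eprod; rw [Multiset.map_zero, Multiset.prod_zero]

/-- Adding an edge multiplies the gate by its factor. [this file] -/
theorem eprod_cons (e : (Fin 3 → Fin (qOf m)) × (Fin 3 → Fin (qOf m)))
    (E : Multiset ((Fin 3 → Fin (qOf m)) × (Fin 3 → Fin (qOf m)))) :
    eprod (e ::ₘ E) = (X e.1 - X e.2) * eprod E := by
  unfold eprod; rw [Multiset.map_cons, Multiset.prod_cons]

/-- File-only helper: an edge factor has total degree `≤ 1`. [this file] -/
theorem totalDegree_X_sub_X_le_one (u v : Fin 3 → Fin (qOf m)) :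
    (X u - X v : MvPolynomial (Fin 3 → Fin (qOf m)) ℂ).totalDegree ≤ 1 :=
  (totalDegree_sub _ _).trans (max_le (totalDegree_X _).le (totalDegree_X _).le)

/-- File-only helper: the image of an edge factor is `q_e = P_u − P_v`. [this file] -/
theorem bind₁_kiPer_X_sub_X (u v : Fin 3 → Fin (qOf m)) :
    bind₁ (kiPer m) (X u - X v : MvPolynomial (Fin 3 → Fin (qOf m)) ℂ) = kiPer m u - kiPer m v := by
  rw [map_sub, bind₁_X_right, bind₁_X_right]

/-- Substituting into a gate factor by factor. [this file] -/
theorem bind₁_eprod {τ : Type*} (g : (Fin 3 → Fin (qOf m)) → MvPolynomial τ ℂ)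
    (E : Multiset ((Fin 3 → Fin (qOf m)) × (Fin 3 → Fin (qOf m)))) :
    bind₁ g (eprod E) = (E.map fun e => g e.1 - g e.2).prod := by
  unfold eprod
  rw [map_multiset_prod, Multiset.map_map]
  refine congrArg Multiset.prod (Multiset.map_congr rfl fun e _ => ?_)
  show bind₁ g (X e.1 - X e.2) = g e.1 - g e.2
  rw [map_sub, bind₁_X_right, bind₁_X_right]

/-- Relabelling a gate = relabelling its edges. [this file] -/
theorem rename_eprod (r : (Fin 3 → Fin (qOf m)) → (Fin 3 → Fin (qOf m)))
    (E : Multiset ((Fin 3 → Fin (qOf m)) × (Fin 3 → Fin (qOf m)))) :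
    rename r (eprod E) = eprod (E.map fun e => (r e.1, r e.2)) := by
  unfold eprod
  rw [map_multiset_prod, Multiset.map_map, Multiset.map_map]
  refine congrArg Multiset.prod (Multiset.map_congr rfl fun e _ => ?_)
  show rename r (X e.1 - X e.2) = X (r e.1) - X (r e.2)
  rw [map_sub, rename_X, rename_X]

/-- A gate with a loop vanishes. [this file] -/
theorem eprod_eq_zero_of_mem {E : Multiset ((Fin 3 → Fin (qOf m)) × (Fin 3 → Fin (qOf m)))}
    {u : Fin 3 → Fin (qOf m)} (h : (u, u) ∈ E) : eprod E = 0 := by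
  unfold eprod
  exact Multiset.prod_eq_zero (Multiset.mem_map.2 ⟨(u, u), h, sub_self _⟩)

/-- `deg (eprod E) ≤ |E|`. [this file] -/
theorem totalDegree_eprod_le (E : Multiset ((Fin 3 → Fin (qOf m)) × (Fin 3 → Fin (qOf m)))) :
    (eprod E).totalDegree ≤ Multiset.card E := by
  induction E using Multiset.induction_on with
  | empty => rw [eprod_zero, totalDegree_one]; exact Nat.zero_le _
  | cons e E ih =>
    rw [eprod_cons, Multiset.card_cons]
    have h1 := totalDegree_X_sub_X_le_one e.1 e.2
    have h2 := totalDegree_mul (X e.1 - X e.2 : MvPolynomial (Fin 3 → Fin (qOf m)) ℂ) (eprod E)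
    omega

/-- A5: `φ(eprod E)` is homogeneous of degree `|E|·m` (`kiPer_isHomogeneous`). [this file] -/
theorem isHomogeneous_kiPer_eprod (E : Multiset ((Fin 3 → Fin (qOf m)) × (Fin 3 → Fin (qOf m)))) :
    (bind₁ (kiPer m) (eprod E)).IsHomogeneous (Multiset.card E * m) := by
  rw [bind₁_eprod]
  induction E using Multiset.induction_on with
  | empty =>
    rw [Multiset.map_zero, Multiset.prod_zero, Multiset.card_zero, zero_mul]
    exact isHomogeneous_one _ _
  | cons e E ih =>
    rw [Multiset.map_cons, Multiset.prod_cons, Multiset.card_cons, add_mul, one_mul, add_comm]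
    exact ((kiPer_isHomogeneous e.1).sub (kiPer_isHomogeneous e.2)).mul ih

/-- A5: `φ(eprod E) ≠ 0` for loopless `E`: `P_u ≠ P_v` for `u ≠ v` (`kiPer_linearIndependent`, `m ≥ 3`). [this file] -/
theorem kiPer_eprod_ne_zero (hm : 3 ≤ m) {E : Multiset ((Fin 3 → Fin (qOf m)) × (Fin 3 → Fin (qOf m)))}
    (hE : ∀ e ∈ E, e.1 ≠ e.2) : bind₁ (kiPer m) (eprod E) ≠ 0 := by
  intro h0
  rw [bind₁_eprod, Multiset.prod_eq_zero_iff, Multiset.mem_map] at h0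
  obtain ⟨e, he, h0⟩ := h0
  exact (kiPer_linearIndependent hm).injective.ne (hE e he) (sub_eq_zero.1 h0)

/-- A2: `P_u − P_v` is prime for `u ≠ v` (`m ≥ 3`): a member of the prime pencil. [this file] -/
theorem prime_kiPer_sub (hm : 3 ≤ m) {u v : Fin 3 → Fin (qOf m)} (h : u ≠ v) :
    Prime (kiPer m u - kiPer m v) := by
  rw [← bind₁_kiPer_X_sub_X]
  refine prime_bind₁_kiPer_of_totalDegree_le_one hm (totalDegree_X_sub_X_le_one u v) ⟨u, ?_⟩
  rw [coeff_sub, coeff_X_same, coeff_X,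
    if_neg (fun h' => h ((Finsupp.single_left_inj one_ne_zero).1 h').symm), sub_zero]
  exact one_ne_zero

/-- A3 RIGIDITY: oriented edges with dividing images coincide (`exists_eq_C_mul_of_associated` + two coefficients).
[this file] -/
theorem edge_eq_of_dvd (hm : 3 ≤ m) {e e' : (Fin 3 → Fin (qOf m)) × (Fin 3 → Fin (qOf m))}
    (he : toLex e.1 < toLex e.2) (he' : toLex e'.1 < toLex e'.2)
    (h : kiPer m e.1 - kiPer m e.2 ∣ kiPer m e'.1 - kiPer m e'.2) : e = e' := by
  have hne : e.1 ≠ e.2 := fun h0 => he.ne (congrArg toLex h0)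
  have hne' : e'.1 ≠ e'.2 := fun h0 => he'.ne (congrArg toLex h0)
  have hassoc : Associated (bind₁ (kiPer m) (X e.1 - X e.2 : MvPolynomial (Fin 3 → Fin (qOf m)) ℂ))
      (bind₁ (kiPer m) (X e'.1 - X e'.2 : MvPolynomial (Fin 3 → Fin (qOf m)) ℂ)) := by
    rw [bind₁_kiPer_X_sub_X, bind₁_kiPer_X_sub_X]
    exact (prime_kiPer_sub hm hne).associated_of_dvd (prime_kiPer_sub hm hne') h
  obtain ⟨ω, hω, hωe⟩ := exists_eq_C_mul_of_associated hm (totalDegree_X_sub_X_le_one e.1 e.2)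
    (totalDegree_X_sub_X_le_one e'.1 e'.2) hassoc
  have hinj : ∀ u w : Fin 3 → Fin (qOf m), Finsupp.single u (1 : ℕ) = Finsupp.single w 1 → u = w :=
    fun u w h0 => (Finsupp.single_left_inj one_ne_zero).1 h0
  -- compare the coefficients of `z_{e.1}` and of `z_{e.2}` in `X e'.1 − X e'.2 = ω · (X e.1 − X e.2)`
  have hc : ∀ w : Fin 3 → Fin (qOf m), coeff (Finsupp.single w 1) (X e'.1 - X e'.2 : MvPolynomial _ ℂ) =
      ω * coeff (Finsupp.single w 1) (X e.1 - X e.2 : MvPolynomial (Fin 3 → Fin (qOf m)) ℂ) := fun w => by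
    rw [hωe, coeff_C_mul]
  have h1 := hc e.1
  have h2 := hc e.2
  rw [coeff_sub, coeff_sub, coeff_X, coeff_X, coeff_X, coeff_X, if_pos rfl,
    if_neg (fun h0 => hne (hinj _ _ h0).symm)] at h1
  rw [coeff_sub, coeff_sub, coeff_X, coeff_X, coeff_X, coeff_X, if_pos rfl,
    if_neg (fun h0 => hne (hinj _ _ h0))] at h2
  have hA : e'.1 = e.1 ∨ e'.2 = e.1 := by
    by_contra hcon
    rw [not_or] at hcon
    rw [if_neg (fun h0 => hcon.1 (hinj _ _ h0)), if_neg (fun h0 => hcon.2 (hinj _ _ h0))] at h1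
    exact hω (by linear_combination -h1)
  have hB : e'.1 = e.2 ∨ e'.2 = e.2 := by
    by_contra hcon
    rw [not_or] at hcon
    rw [if_neg (fun h0 => hcon.1 (hinj _ _ h0)), if_neg (fun h0 => hcon.2 (hinj _ _ h0))] at h2
    exact hω (by linear_combination h2)
  rcases hA with hA | hA
  · rcases hB with hB | hB
    · exact absurd (hA.symm.trans hB) hne
    · exact Prod.ext hA.symm hB.symm
  · rcases hB with hB | hB
    · rw [hB, hA] at he'
      exact absurd he' (lt_asymm he)
    · exact absurd (hA.symm.trans hB) hne

/-- A4 PRIME AVOIDANCE: `q_e ∤ α·φ(eprod E)` for oriented `E ∌ e`, `α ≠ 0`. [this file] -/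
theorem not_dvd_kiPer_gate (hm : 3 ≤ m) {e : (Fin 3 → Fin (qOf m)) × (Fin 3 → Fin (qOf m))}
    (he : toLex e.1 < toLex e.2) {E : Multiset ((Fin 3 → Fin (qOf m)) × (Fin 3 → Fin (qOf m)))}
    (ho : ∀ e' ∈ E, toLex e'.1 < toLex e'.2) (heE : e ∉ E) {α : ℂ} (hα : α ≠ 0) :
    ¬ (kiPer m e.1 - kiPer m e.2 ∣ C α * bind₁ (kiPer m) (eprod E)) := by
  intro h
  have hp := prime_kiPer_sub hm (show e.1 ≠ e.2 from fun h0 => he.ne (congrArg toLex h0))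
  rw [bind₁_eprod] at h
  rcases hp.dvd_or_dvd h with h | h
  · exact hp.not_unit (isUnit_of_dvd_unit h (IsUnit.map C (isUnit_iff_ne_zero.2 hα)))
  · obtain ⟨q', hq', hdvd⟩ := hp.exists_mem_multiset_dvd h
    obtain ⟨e', he'E, rfl⟩ := Multiset.mem_map.1 hq'
    rw [edge_eq_of_dvd hm he (ho e' he'E) hdvd] at heE
    exact heE he'E

/-- CONTRACT for the collapse `ρ_e = repL [e]` (`z_v ↦ z_u`, `e = (u, v)`): `φ_L ∘ ρ_e = φ_L` once `e ∈ L`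
(`wordL_snd_eq`). [this file] -/
theorem bind₁_wordL_rename_repL {L : List ((Fin 3 → Fin (qOf m)) × (Fin 3 → Fin (qOf m)))}
    {e : (Fin 3 → Fin (qOf m)) × (Fin 3 → Fin (qOf m))} (he : e ∈ L)
    (D : MvPolynomial (Fin 3 → Fin (qOf m)) ℂ) :
    bind₁ (fun c => wordPoly m (wordL m L c)) (rename (repL [e]) D) =
      bind₁ (fun c => wordPoly m (wordL m L c)) D := by
  have hrep : ∀ c : Fin 3 → Fin (qOf m), repL [e] c = if c = e.2 then e.1 else c := fun c => rfl
  rw [bind₁_rename]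
  refine congrArg (fun P : (Fin 3 → Fin (qOf m)) → MvPolynomial (Fin (qOf m) × Fin (qOf m)) ℂ => bind₁ P D)
    (funext fun c => ?_)
  show wordPoly m (wordL m L (repL [e] c)) = wordPoly m (wordL m L c)
  rw [hrep]
  by_cases h : c = e.2
  · rw [if_pos h, h, wordL_snd_eq he]
  · rw [if_neg h]

/-- (C) TWO GATES UNDER PATCHES. For a patch list `L` with pairwise distinct merged blocks and `2·3^(|L|+1) < m²`:
two gates on loopless edges avoiding the merged blocks, `β·eprod A + γ·eprod B ≠ 0 ⟹ φ_L(β·eprod A + γ·eprod B) ≠ 0`.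
Induction on `|A| + |B|` — zero coefficient / SURVIVE; MERGE an edge of one gate that is neither in the other nor
reversed there (KILL + CONTRACT + SURVIVE + TRANSFER); else peel a common factor `z_u − z_v = −(z_v − z_u)`.
[this file] -/
theorem bind₁_wordL_twoGates_ne_zero {L : List ((Fin 3 → Fin (qOf m)) × (Fin 3 → Fin (qOf m)))}
    (hB : L.Pairwise fun p p' => p.2 ≠ p'.2) (hmL : 2 * 3 ^ (L.length + 1) < m * m) :
    ∀ (A B : Multiset ((Fin 3 → Fin (qOf m)) × (Fin 3 → Fin (qOf m)))) (β γ : ℂ),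
      (∀ e ∈ A + B, e.1 ≠ e.2 ∧ (∀ p ∈ L, e.1 ≠ p.2) ∧ ∀ p ∈ L, e.2 ≠ p.2) →
      C β * eprod A + C γ * eprod B ≠ 0 →
      bind₁ (fun c => wordPoly m (wordL m L c)) (C β * eprod A + C γ * eprod B) ≠ 0 := by
  have hmL0 : 2 * 3 ^ L.length < m * m :=
    lt_of_le_of_lt (Nat.mul_le_mul_left 2 (Nat.pow_le_pow_right (by norm_num) (Nat.le_succ _))) hmL
  have hsurv : ∀ N : Multiset ((Fin 3 → Fin (qOf m)) × (Fin 3 → Fin (qOf m))),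
      (∀ e ∈ N, e.1 ≠ e.2 ∧ (∀ p ∈ L, e.1 ≠ p.2) ∧ ∀ p ∈ L, e.2 ≠ p.2) →
      bind₁ (fun c => wordPoly m (wordL m L c)) (eprod N) ≠ 0 := by
    intro N hN h0
    rw [bind₁_eprod, Multiset.prod_eq_zero_iff, Multiset.mem_map] at h0
    obtain ⟨e, he, h0⟩ := h0
    obtain ⟨hne, hl₁, hl₂⟩ := hN e he
    exact wordPoly_wordL_ne' hB hmL0 hne hl₁ hl₂ (sub_eq_zero.1 h0)
  -- MERGE: an edge `e` of `A` neither in `B` nor reversed in `B`; merge `e.2` into `e.1`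
  have hmerge : ∀ (A B : Multiset ((Fin 3 → Fin (qOf m)) × (Fin 3 → Fin (qOf m)))) (β γ : ℂ),
      (∀ e ∈ A + B, e.1 ≠ e.2 ∧ (∀ p ∈ L, e.1 ≠ p.2) ∧ ∀ p ∈ L, e.2 ≠ p.2) → γ ≠ 0 →
      ∀ e ∈ A, e ∉ B → e.swap ∉ B →
      bind₁ (fun c => wordPoly m (wordL m L c)) (C β * eprod A + C γ * eprod B) ≠ 0 := by
    intro A B β γ hAB hγ e heA heB hesB
    obtain ⟨hne, hl₁, hl₂⟩ := hAB e (Multiset.mem_add.2 (Or.inl heA))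
    have hB' : (e :: L).Pairwise fun p p' => p.2 ≠ p'.2 := List.pairwise_cons.2 ⟨hl₂, hB⟩
    have hmL' : 2 * 3 ^ (e :: L).length < m * m := by rw [List.length_cons]; exact hmL
    have he : e ∈ e :: L := List.mem_cons_self
    have hrep : ∀ c : Fin 3 → Fin (qOf m), repL [e] c = if c = e.2 then e.1 else c := fun c => rfl
    refine bind₁_wordL_ne_zero_of_cons e ?_
    have hkill : bind₁ (fun c => wordPoly m (wordL m (e :: L) c)) (eprod A) = 0 := by
      rw [bind₁_eprod]
      refine Multiset.prod_eq_zero (Multiset.mem_map.2 ⟨e, heA, ?_⟩)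
      show wordPoly m (wordL m (e :: L) e.1) - wordPoly m (wordL m (e :: L) e.2) = 0
      rw [wordL_snd_eq he, sub_self]
    rw [map_add, map_mul, map_mul, hkill, mul_zero, zero_add, bind₁_C_right,
      ← bind₁_wordL_rename_repL he (eprod B), rename_eprod]
    refine mul_ne_zero (MvPolynomial.C_ne_zero.2 hγ) fun h0 => ?_
    rw [bind₁_eprod, Multiset.prod_eq_zero_iff, Multiset.mem_map] at h0
    obtain ⟨d', hd', h0⟩ := h0
    obtain ⟨d, hdB, rfl⟩ := Multiset.mem_map.1 hd'
    obtain ⟨hdne, hd₁, hd₂⟩ := hAB d (Multiset.mem_add.2 (Or.inr hdB))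
    have h1 : wordPoly m (wordL m (e :: L) (repL [e] d.1)) = wordPoly m (wordL m (e :: L) (repL [e] d.2)) :=
      sub_eq_zero.1 h0
    rw [hrep, hrep] at h1
    have hlive : ∀ x : Fin 3 → Fin (qOf m), (∀ p ∈ L, x ≠ p.2) →
        ∀ p ∈ e :: L, (if x = e.2 then e.1 else x) ≠ p.2 := by
      intro x hx p hp
      by_cases hx' : x = e.2
      · rw [if_pos hx']
        rcases List.mem_cons.1 hp with hp | hp
        · rw [hp]; exact hne
        · exact hl₁ p hp
      · rw [if_neg hx']
        rcases List.mem_cons.1 hp with hp | hp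
        · rw [hp]; exact hx'
        · exact hx p hp
    refine wordPoly_wordL_ne' hB' hmL' ?_ (hlive d.1 hd₁) (hlive d.2 hd₂) h1
    by_cases h1' : d.1 = e.2
    · have h2' : ¬ d.2 = e.2 := fun h2' => hdne (h1'.trans h2'.symm)
      rw [if_pos h1', if_neg h2']
      exact fun h => hesB (by rw [show e.swap = d from Prod.ext h1'.symm h]; exact hdB)
    · by_cases h2' : d.2 = e.2
      · rw [if_neg h1', if_pos h2']
        exact fun h => heB (by rw [show e = d from Prod.ext h.symm h2'.symm]; exact hdB)
      · rw [if_neg h1', if_neg h2']; exact hdne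
  have step : ∀ (A B : Multiset ((Fin 3 → Fin (qOf m)) × (Fin 3 → Fin (qOf m)))) (β γ : ℂ),
      (∀ (A' B' : Multiset ((Fin 3 → Fin (qOf m)) × (Fin 3 → Fin (qOf m)))) (β' γ' : ℂ),
        Multiset.card A' + Multiset.card B' < Multiset.card A + Multiset.card B →
        (∀ e ∈ A' + B', e.1 ≠ e.2 ∧ (∀ p ∈ L, e.1 ≠ p.2) ∧ ∀ p ∈ L, e.2 ≠ p.2) →
        C β' * eprod A' + C γ' * eprod B' ≠ 0 →
        bind₁ (fun c => wordPoly m (wordL m L c)) (C β' * eprod A' + C γ' * eprod B') ≠ 0) →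
      (∀ e ∈ A + B, e.1 ≠ e.2 ∧ (∀ p ∈ L, e.1 ≠ p.2) ∧ ∀ p ∈ L, e.2 ≠ p.2) →
      C β * eprod A + C γ * eprod B ≠ 0 →
      bind₁ (fun c => wordPoly m (wordL m L c)) (C β * eprod A + C γ * eprod B) ≠ 0 := by
    intro A B β γ ih hAB hf
    by_cases hβ : β = 0
    · rw [hβ, C_0, zero_mul, zero_add] at hf ⊢
      rw [map_mul, bind₁_C_right]
      exact mul_ne_zero (MvPolynomial.C_ne_zero.2 (MvPolynomial.C_ne_zero.1 (left_ne_zero_of_mul hf)))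
        (hsurv B fun e he => hAB e (Multiset.mem_add.2 (Or.inr he)))
    by_cases hγ : γ = 0
    · rw [hγ, C_0, zero_mul, add_zero] at hf ⊢
      rw [map_mul, bind₁_C_right]
      exact mul_ne_zero (MvPolynomial.C_ne_zero.2 (MvPolynomial.C_ne_zero.1 (left_ne_zero_of_mul hf)))
        (hsurv A fun e he => hAB e (Multiset.mem_add.2 (Or.inl he)))
    by_cases hA : ∃ e ∈ A, e ∉ B ∧ e.swap ∉ B
    · obtain ⟨e, heA, heB, hesB⟩ := hA
      exact hmerge A B β γ hAB hγ e heA heB hesB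
    by_cases hB2 : ∃ e ∈ B, e ∉ A ∧ e.swap ∉ A
    · obtain ⟨e, heB, heA, hesA⟩ := hB2
      rw [add_comm]
      exact hmerge B A γ β (fun e' he' => hAB e' (by rwa [add_comm])) hβ e heB heA hesA
    -- every edge of `A` lies in `B` up to orientation, and conversely: peel a common factor
    rcases Multiset.empty_or_exists_mem A with hA0 | ⟨e, heA⟩
    · rcases Multiset.empty_or_exists_mem B with hB0 | ⟨e, heB⟩
      · rw [hA0, hB0, eprod_zero, mul_one, mul_one, ← C_add] at hf ⊢
        rw [bind₁_C_right]
        exact MvPolynomial.C_ne_zero.2 (MvPolynomial.C_ne_zero.1 hf)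
      · exact (hB2 ⟨e, heB, by rw [hA0]; exact Multiset.notMem_zero e, by rw [hA0]; exact Multiset.notMem_zero _⟩).elim
    have hcase : e ∈ B ∨ e.swap ∈ B := by
      by_contra hcon
      rw [not_or] at hcon
      exact hA ⟨e, heA, hcon.1, hcon.2⟩
    obtain ⟨hne, hl₁, hl₂⟩ := hAB e (Multiset.mem_add.2 (Or.inl heA))
    have hWe : bind₁ (fun c => wordPoly m (wordL m L c))
        (X e.1 - X e.2 : MvPolynomial (Fin 3 → Fin (qOf m)) ℂ) ≠ 0 := by
      rw [map_sub, bind₁_X_right, bind₁_X_right]; exact sub_ne_zero.2 (wordPoly_wordL_ne' hB hmL0 hne hl₁ hl₂)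
    have hAB' : ∀ (A' B' : Multiset ((Fin 3 → Fin (qOf m)) × (Fin 3 → Fin (qOf m))))
        (a b : (Fin 3 → Fin (qOf m)) × (Fin 3 → Fin (qOf m))), A = a ::ₘ A' → B = b ::ₘ B' →
        ∀ e' ∈ A' + B', e'.1 ≠ e'.2 ∧ (∀ p ∈ L, e'.1 ≠ p.2) ∧ ∀ p ∈ L, e'.2 ≠ p.2 := by
      intro A' B' a b hA' hB' e' he'
      rw [hA', hB'] at hAB
      exact hAB e' (Multiset.mem_add.2
        ((Multiset.mem_add.1 he').imp Multiset.mem_cons_of_mem Multiset.mem_cons_of_mem))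
    obtain ⟨A', hA'⟩ := Multiset.exists_cons_of_mem heA
    rcases hcase with heB | hesB
    · obtain ⟨B', hB'⟩ := Multiset.exists_cons_of_mem heB
      have hfac : C β * eprod A + C γ * eprod B = (X e.1 - X e.2) * (C β * eprod A' + C γ * eprod B') := by
        rw [hA', hB', eprod_cons, eprod_cons]; ring
      rw [hfac] at hf ⊢
      rw [map_mul]
      refine mul_ne_zero hWe (ih A' B' β γ ?_ (hAB' A' B' e e hA' hB') (right_ne_zero_of_mul hf))
      rw [hA', hB', Multiset.card_cons, Multiset.card_cons]; omega
    · obtain ⟨B', hB'⟩ := Multiset.exists_cons_of_mem hesB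
      have hfac : C β * eprod A + C γ * eprod B = (X e.1 - X e.2) * (C β * eprod A' + C (-γ) * eprod B') := by
        rw [hA', hB', eprod_cons, eprod_cons, Prod.fst_swap, Prod.snd_swap, map_neg]; ring
      rw [hfac] at hf ⊢
      rw [map_mul]
      refine mul_ne_zero hWe (ih A' B' β (-γ) ?_ (hAB' A' B' e e.swap hA' hB') (right_ne_zero_of_mul hf))
      rw [hA', hB', Multiset.card_cons, Multiset.card_cons]; omega
  have main : ∀ (n : ℕ) (A B : Multiset ((Fin 3 → Fin (qOf m)) × (Fin 3 → Fin (qOf m)))) (β γ : ℂ),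
      Multiset.card A + Multiset.card B ≤ n →
      (∀ e ∈ A + B, e.1 ≠ e.2 ∧ (∀ p ∈ L, e.1 ≠ p.2) ∧ ∀ p ∈ L, e.2 ≠ p.2) →
      C β * eprod A + C γ * eprod B ≠ 0 →
      bind₁ (fun c => wordPoly m (wordL m L c)) (C β * eprod A + C γ * eprod B) ≠ 0 := by
    intro n
    induction n with
    | zero =>
      intro A B β γ hn hAB hf
      exact step A B β γ (fun A' B' β' γ' hlt _ _ => absurd hlt (by omega)) hAB hf
    | succ n ih =>
      intro A B β γ hn hAB hf
      exact step A B β γ (fun A' B' β' γ' hlt => ih A' B' β' γ' (by omega)) hAB hf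
  exact fun A B β γ => main _ A B β γ le_rfl

end Summit.ValiantsHypothesis.ValiantsHypothesis.Theorems.DefinabilityGapEdgeGates

end
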